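import Literature.AlgebraicGeometry.ComplexMultiplication.ShimuraInflationCodes
import Literature.AlgebraicGeometry.HodgeTheory.HodgeFiltrationModels
import Literature.AlgebraicGeometry.Motives.VarietiesDimensionProofs
import HarnessLib

/-!
# Shimura's type inflation read on `H¹(−, ℚ)`, from Riemann's theorem — light form

Family `hodge`, layer `Literature/AlgebraicGeometry/ComplexMultiplication`; KERNEL ONLY (theorems; no
definition, no new hypothesis minted, NO record imported).  The one non-kernel input, Riemann's theorem
— fullness of `A ↦ H¹_B(A, ℚ)` on complex abelian varieties up to isogeny, [DeligneMilne1982Tannakian]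
Thm. 6.20 — enters as the EXPLICIT HYPOTHESIS `hR` of the two theorems (section `Theorems`), written in the
typed shape of the record `HodgeTheory.DeligneMilne1982_Thm_6_20_full` (record file
`HodgeTheory/AbelianVarietyHodgeFullnessRecord`) with its Hodge-morphism premise spelled out and RESTRICTED to
abelian varieties carrying a Hodge model of the tree (premises `Nonempty (HodgeModel _ _)` on both varieties,
under which the Hodge-type premise is not vacuous); a consumer holding the record feeds it in by a one-line
lambda.  The other standing input is the Hodge-theory fact `HodgeTheory.hodgePQ_independent_of_hodgeModel`
(the Hodge type of a class does not depend on the Hodge model, [VoisinHodgeI2002] Prop. 6.11 / §7.3.2;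
`HodgeTheory/HodgeFiltrationModels`), a hypothesis `hI`.

WHAT IS PROVED.  `thm3_rational_of_riemann`: for a realisation `(A, ι, θ)` of a CM type `(K; Φ)` and a
realisation `(A′, ι′, θ′)` of the INDUCED type `(M; Φ^M)` along `k : K → M`
(`ShimuraIsogeny.IsCMTypeRealisation`, `InducedCMType.inducedCMType`), there are finitely many scheme
morphisms `p_j : A′ → A` with `⊕_j p_j^* : H¹(A(ℂ); ℚ)^m → H¹(A′(ℂ); ℚ)` bijective and
`p_j^* ∘ a = k(a) ∘ p_j^*` on `H¹(−, ℚ)` for the rational CM actions (`BettiUniverse.cmAction`) — i.e.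
EXACTLY the conclusion of `ShimuraIsogenyBetti.Shimura1998_Thm3_inflation.rational`, the `H¹(−, ℚ)`-level
reading of Shimura's §6.2 Theorem 3 inflation (`ShimuraIsogeny.Shimura1998_Thm3_inflation`) that the
period / theta constructions consume; and `thm3_rational_transport_of_riemann`, its transport to coded
fields, EXACTLY the conclusion of `ShimuraInflationCodes.Shimura1998_Thm3_inflation.rational_transport`.
Neither Shimura's isogeny `A′ ∼ B^h` (`Shimura1998_Thm3_isogenousPower`) nor the uniqueness-up-to-isogeny
record (`Shimura1998_Thm2_Cor`) nor any product of abelian varieties is used.  The morphism-level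
statement `Shimura1998_Thm3_inflation` itself (equivariance `ι′(k a) ∘ p_j = p_j ∘ ι(a)` as morphisms of
abelian varieties) needs in addition that a homomorphism of complex abelian varieties is determined by
`H¹`; it is derived in the sibling file `ShimuraInflationOfRiemann` over the scheme-level theory and is
not needed on `H¹(−, ℚ)`.

PROOF.  (1) `K` acts on `V = H¹(A(ℂ); ℚ)` and on `V′ = H¹(A′(ℂ); ℚ)` through `cmAction θ`,
`cmAction θ′ ∘ k`; `dim_ℚ V = [K:ℚ]` makes `V` a `K`-line and `V′ ≅ K^m`, whence `K`-linear
`ψ_j : V → V′` with `⊕_j ψ_j : V^m ≅ V′` (`exists_cmLinear_sum_bijective`, linear algebra).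
(2) A `K`-equivariant map is a morphism of Hodge structures of weight one
(`cmEquivariant_respects_hodgeTypes`): `H¹(A(ℂ); ℂ)` has an eigenbasis indexed by the embeddings
`σ : K → ℂ` (`exists_basis_mem_eigenline`); in ONE FIXED Hodge model (legitimate by
`hodgePQ_independent_of_hodgeModel.isOfHodgeType_iff`) the classes of type `(1,0)` and `(0,1)` form two
DISJOINT subspaces (`disjoint_comap_hodgePQ`, from the Hodge decomposition of the model,
`HodgeModel.iSupIndep_ratPiece`), so a class of type `(1,0)` (resp. `(0,1)`) is supported on `σ ∈ Φ`
(resp. `σ ∉ Φ`) (`eq_sum_filter_of_mem_of_disjoint`); the `σ`-line goes to the sum of the `τ`-lines of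
`A′` over `τ|_K = σ` (`repr_apply_eq_zero_of_comp_ne`), and `τ ∈ Φ^M ↔ τ|_K ∈ Φ`
(`mem_inducedCMType_iff`) matches the types (`isOfHodgeType_map_of_cmEquivariant`); every realisation
carries a Hodge model (`IsCMTypeRealisation.nonempty_hodgeModel_dim`).  (3) Fullness (`hR`) gives
`u_j : A′ → A`, `k_j ≥ 1`, `u_j^* = k_j ψ_j`; `⊕_j u_j^* = (⊕_j ψ_j) ∘ diag(k_j)` is bijective
(`bijective_sum_proj_of_nsmul`) and `u_j^*` is `K`-equivariant because `ψ_j` is.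

## References

* [Shimura1998] G. Shimura, *Abelian Varieties with Complex Multiplication and Modular Functions*
  (Princeton 1998), §6.2 Theorem 3 with proof, §6.1 Theorem 2 with Corollary and Remark (the statement
  read here on `H¹(−, ℚ)` is the record `ShimuraIsogeny.Shimura1998_Thm3_inflation`'s rational form).
* [DeligneMilne1982Tannakian] P. Deligne, J. S. Milne, *Tannakian Categories*, LNM 900 (1982),
  pp. 101–228, §6 Theorem 6.20 (Riemann) (the fullness input `hR`; typed as the record
  `HodgeTheory/AbelianVarietyHodgeFullnessRecord`, not imported here).
* [Deligne1982HodgeCycles] P. Deligne (notes by J. S. Milne), *Hodge cycles on abelian varieties*, LNM 900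
  (1982), §4–§5 (`E`-actions on `H¹`, eigen-decomposition, CM types).
* [VoisinHodgeI2002] C. Voisin, *Hodge Theory and Complex Algebraic Geometry I* (2002), Cor. 6.10
  (the Hodge decomposition as a direct sum), Prop. 6.11 (independence of the choices), Cor. 6.14 (a class
  of two distinct types `(p,q) ≠ (p′,q′)` is zero), §7.1.1, §7.3.2 (held text
  `book:voisin2002-hodge-theory-complex-algebraic-geometry-i`, chunks p0120 L55, p0121 L13, p0121 L31).
-/

noncomputable section

open scoped TensorProduct
open NumberField CategoryTheory Module

namespace Literature.AlgebraicGeometry.ComplexMultiplication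

open Literature.AlgebraicGeometry.Motives (SchemeOver IsSmoothProjective CMType AbelianVariety bettiCohomology
  ofRatClassBaseChange ComplexPoints)
open Literature.AlgebraicGeometry.HodgeTheory (complexBetti IsOfHodgeType HodgeModel ofRatClassBaseChangeEquiv
  hodgePQ_independent_of_hodgeModel)
open Literature.AlgebraicGeometry.HodgeTheory.BettiUniverse (pull pull_comp cmAction IsInducedOnIntegers
  ofRatClassBaseChange_cmAction)
open Literature.AlgebraicTopology.SingularHomology
open Literature.NumberTheory.Automorphic.PicardCM (eigenline)
open Literature.NumberTheory.ComplexMultiplication (inducedCMType mem_inducedCMType_iff)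

/-! ## Linear algebra: a `K`-line and a `K`-space are compared by `K`-linear coordinates -/

section LinearAlgebra

variable {K : Type} [Field K] [NumberField K]
  {V V' : Type*} [AddCommGroup V] [Module ℚ V] [AddCommGroup V'] [Module ℚ V']

/-- If a number field `K` acts `ℚ`-linearly on finite-dimensional `ℚ`-spaces `V`, `V′` with
`dim_ℚ V = [K : ℚ]`, then `V` is a `K`-line, `V′ ≅ K^m`, and there are `K`-equivariant `ℚ`-linear maps
`ψ_j : V → V′` (`j < m`) with `(v_j)_j ↦ ∑_j ψ_j v_j` a bijection `V^m → V′`. [folklore] -/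
theorem exists_cmLinear_sum_bijective [Module.Finite ℚ V] [Module.Finite ℚ V']
    (ρ : K →ₐ[ℚ] Module.End ℚ V) (ρ' : K →ₐ[ℚ] Module.End ℚ V')
    (hV : Module.finrank ℚ V = Module.finrank ℚ K) :
    ∃ (m : ℕ) (ψ : Fin m → (V →ₗ[ℚ] V')),
      Function.Bijective (∑ j : Fin m, ψ j ∘ₗ LinearMap.proj j : (Fin m → V) →ₗ[ℚ] V') ∧
      ∀ (j : Fin m) (a : K) (v : V), ψ j (ρ a v) = ρ' a (ψ j v) := by
  letI instKV : Module K V := Module.compHom V ρ.toRingHom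
  letI instKV' : Module K V' := Module.compHom V' ρ'.toRingHom
  have hsmul : ∀ (a : K) (v : V), a • v = ρ a v := fun _ _ ↦ rfl
  have hsmul' : ∀ (a : K) (v : V'), a • v = ρ' a v := fun _ _ ↦ rfl
  haveI : IsScalarTower ℚ K V :=
    ⟨fun q a v ↦ by rw [hsmul, hsmul, map_smul, LinearMap.smul_apply]⟩
  haveI : IsScalarTower ℚ K V' :=
    ⟨fun q a v ↦ by rw [hsmul', hsmul', map_smul, LinearMap.smul_apply]⟩
  haveI : Module.Finite K V := Module.Finite.of_restrictScalars_finite ℚ K V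
  haveI : Module.Finite K V' := Module.Finite.of_restrictScalars_finite ℚ K V'
  have h1 : Module.finrank K V = 1 := by
    have hmul := Module.finrank_mul_finrank ℚ K V
    rw [hV] at hmul
    exact Nat.eq_of_mul_eq_mul_left Module.finrank_pos (by rw [mul_one]; exact hmul)
  let bV : Basis (Fin 1) K V := Module.finBasisOfFinrankEq K V h1
  let bV' : Basis (Fin (Module.finrank K V')) K V' := Module.finBasis K V'
  -- the `K`-linear maps `v ↦ (coordinate of v) • b′_j`
  let L : Fin (Module.finrank K V') → (V →ₗ[K] V') := fun j ↦
    (LinearMap.toSpanSingleton K V' (bV' j)) ∘ₗ (bV.coord 0)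
  refine ⟨Module.finrank K V', fun j ↦ (L j).restrictScalars ℚ, ?_, ?_⟩
  · -- the sum map is `b′.equivFun.symm ∘ (coordinates)`, a composite of two bijections
    let e : V ≃ₗ[K] K := bV.repr.trans (Finsupp.uniqueLinearEquiv K K (0 : Fin 1))
    let E : (Fin (Module.finrank K V') → V) ≃ₗ[K] (Fin (Module.finrank K V') → K) :=
      LinearEquiv.piCongrRight fun _ ↦ e
    have key : ⇑(∑ j : Fin (Module.finrank K V'), (L j).restrictScalars ℚ ∘ₗ LinearMap.proj j :
          (Fin (Module.finrank K V') → V) →ₗ[ℚ] V') =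
        ⇑bV'.equivFun.symm ∘ ⇑E := by
      funext w
      rw [Function.comp_apply, Basis.equivFun_symm_apply, LinearMap.coe_sum, Finset.sum_apply]
      refine Finset.sum_congr rfl fun j _ ↦ ?_
      simp only [L, E, e, LinearMap.coe_comp, LinearMap.coe_restrictScalars, Function.comp_apply,
        LinearMap.proj_apply, LinearMap.toSpanSingleton_apply, Basis.coord_apply,
        LinearEquiv.piCongrRight_apply, LinearEquiv.trans_apply, Finsupp.uniqueLinearEquiv_apply]
    rw [key]
    exact bV'.equivFun.symm.bijective.comp E.bijective
  · intro j a v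
    change L j (ρ a v) = ρ' a (L j v)
    rw [← hsmul, ← hsmul', map_smul]

/-- A sum map `(v_j)_j ↦ ∑_j T_j v_j` whose summands are positive integer multiples `T_j = n_j • ψ_j` of the
summands of a bijective sum map is bijective. [folklore] -/
theorem bijective_sum_proj_of_nsmul {m : ℕ} (ψ T : Fin m → (V →ₗ[ℚ] V'))
    (hψ : Function.Bijective (∑ j : Fin m, ψ j ∘ₗ LinearMap.proj j : (Fin m → V) →ₗ[ℚ] V'))
    (n : Fin m → ℕ) (hn : ∀ j, 0 < n j) (hT : ∀ j x, T j x = n j • ψ j x) :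
    Function.Bijective (∑ j : Fin m, T j ∘ₗ LinearMap.proj j : (Fin m → V) →ₗ[ℚ] V') := by
  -- `D w = (n_j • w_j)_j` is a bijection and `∑ T_j ∘ proj_j = (∑ ψ_j ∘ proj_j) ∘ D`
  have hnz : ∀ j, (n j : ℚ) ≠ 0 := fun j ↦ by exact_mod_cast (hn j).ne'
  let D : (Fin m → V) → (Fin m → V) := fun w j ↦ (n j : ℚ) • w j
  have hD : Function.Bijective D := by
    refine Function.bijective_iff_has_inverse.2 ⟨fun w j ↦ (n j : ℚ)⁻¹ • w j, fun w ↦ ?_, fun w ↦ ?_⟩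
    · funext j; exact inv_smul_smul₀ (hnz j) (w j)
    · funext j; exact smul_inv_smul₀ (hnz j) (w j)
  have key : ⇑(∑ j : Fin m, T j ∘ₗ LinearMap.proj j : (Fin m → V) →ₗ[ℚ] V') =
      ⇑(∑ j : Fin m, ψ j ∘ₗ LinearMap.proj j : (Fin m → V) →ₗ[ℚ] V') ∘ D := by
    funext w
    rw [Function.comp_apply, LinearMap.coe_sum, LinearMap.coe_sum, Finset.sum_apply, Finset.sum_apply]
    refine Finset.sum_congr rfl fun j _ ↦ ?_
    simp only [LinearMap.coe_comp, Function.comp_apply, LinearMap.proj_apply, D, hT, Nat.cast_smul_eq_nsmul,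
      map_nsmul]
  rw [key]
  exact hψ.comp hD

end LinearAlgebra

/-! ## Support of a vector in a basis adapted to two disjoint subspaces -/

section Support

variable {W W' : Type*} [AddCommGroup W] [Module ℂ W] [AddCommGroup W'] [Module ℂ W']
  {ι ι' : Type*} [Fintype ι] [Fintype ι']

/-- **Support.** If a basis `(b_i)` of `W` has `b_i ∈ T₁` for `i ∈ P` and `b_i ∈ T₂` for `i ∉ P`, with
`T₁ ∩ T₂ = 0`, then a vector of `T₁` has coordinates only on `P`. [folklore] -/
theorem eq_sum_filter_of_mem_of_disjoint (b : Basis ι ℂ W) (P : ι → Prop) [DecidablePred P]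
    {T₁ T₂ : Submodule ℂ W} (hT : Disjoint T₁ T₂)
    (hP : ∀ i, P i → b i ∈ T₁) (hnP : ∀ i, ¬ P i → b i ∈ T₂) {c : W} (hc : c ∈ T₁) :
    c = ∑ i ∈ Finset.univ.filter P, b.repr c i • b i := by
  set cp := ∑ i ∈ Finset.univ.filter P, b.repr c i • b i with hcp
  set cm := ∑ i ∈ Finset.univ.filter (fun i ↦ ¬ P i), b.repr c i • b i with hcm
  have hsplit : c = cp + cm := by
    rw [hcp, hcm, Finset.sum_filter_add_sum_filter_not, b.sum_repr]
  have hp : cp ∈ T₁ :=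
    Submodule.sum_mem _ fun i hi ↦ Submodule.smul_mem _ _ (hP i (Finset.mem_filter.1 hi).2)
  have hm₂ : cm ∈ T₂ :=
    Submodule.sum_mem _ fun i hi ↦ Submodule.smul_mem _ _ (hnP i (Finset.mem_filter.1 hi).2)
  have hm : cm ∈ T₁ := by
    have : cm = c - cp := by rw [hsplit, add_sub_cancel_left]
    rw [this]
    exact Submodule.sub_mem _ hc hp
  have hm0 : cm = 0 := (Submodule.disjoint_def.1 hT) cm hm hm₂
  rw [hsplit, hm0, add_zero]

/-- **Transport along a map with controlled support.** In the situation of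
`eq_sum_filter_of_mem_of_disjoint` for `W`, let `(b′_{i′})` be a basis of `W′` whose members indexed by
`P′` lie in `T₁′`, and let `Ψ : W → W′` be linear with `Ψ(b_i)` (`i ∈ P`) supported on `P′`.  Then
`Ψ(T₁) ⊆ T₁′`. [folklore] -/
theorem mem_of_apply_of_support (b : Basis ι ℂ W) (b' : Basis ι' ℂ W')
    (P : ι → Prop) (P' : ι' → Prop) [DecidablePred P] [DecidablePred P']
    {T₁ T₂ : Submodule ℂ W} {T₁' : Submodule ℂ W'} (hT : Disjoint T₁ T₂)
    (hP : ∀ i, P i → b i ∈ T₁) (hnP : ∀ i, ¬ P i → b i ∈ T₂) (hP' : ∀ i', P' i' → b' i' ∈ T₁')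
    (Ψ : W →ₗ[ℂ] W') (hsupp : ∀ i, P i → ∀ i', ¬ P' i' → b'.repr (Ψ (b i)) i' = 0)
    {c : W} (hc : c ∈ T₁) : Ψ c ∈ T₁' := by
  rw [eq_sum_filter_of_mem_of_disjoint b P hT hP hnP hc, map_sum]
  refine Submodule.sum_mem _ fun i hi ↦ ?_
  have hPi : P i := (Finset.mem_filter.1 hi).2
  rw [map_smul]
  refine Submodule.smul_mem _ _ ?_
  have hwsum : Ψ (b i) = ∑ i' ∈ Finset.univ.filter P', b'.repr (Ψ (b i)) i' • b' i' := by
    conv_lhs => rw [← b'.sum_repr (Ψ (b i))]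
    rw [← Finset.sum_filter_add_sum_filter_not Finset.univ P',
      Finset.sum_eq_zero (s := Finset.univ.filter fun i' ↦ ¬ P' i'), add_zero]
    intro i' hi'
    rw [hsupp i hPi i' (Finset.mem_filter.1 hi').2, zero_smul]
  rw [hwsum]
  exact Submodule.sum_mem _ fun i' hi' ↦ Submodule.smul_mem _ _ (hP' i' (Finset.mem_filter.1 hi').2)

end Support

/-! ## Eigenbases for CM actions and the support of equivariant images -/

section Eigen

variable {K : Type} [Field K] [NumberField K]

/-- Distinct complex embeddings of a number field take distinct values at a power-basis generator.
[folklore] -/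
theorem ringHom_apply_gen_injective (K : Type) [Field K] [NumberField K] :
    Function.Injective fun σ : K →+* ℂ ↦ σ (Field.powerBasisOfFiniteOfSeparable ℚ K).gen := by
  intro σ τ hστ
  have h : σ.toRatAlgHom = τ.toRatAlgHom :=
    (Field.powerBasisOfFiniteOfSeparable ℚ K).algHom_ext (by simpa using hστ)
  rw [← RingHom.toRatAlgHom_toRingHom σ, ← RingHom.toRatAlgHom_toRingHom τ, h]

variable {W W' : Type*} [AddCommGroup W] [Module ℂ W] [AddCommGroup W'] [Module ℂ W']

omit [NumberField K] in
/-- On an eigenvector, `θ(a)` is the scalar `σ(a)`. [folklore] -/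
theorem eigenline_apply_eq_smul {θ : K →+* Module.End ℂ W} {v : W} {σ : K →+* ℂ}
    (hv : v ∈ eigenline θ σ) (a : K) : θ a v = σ a • v :=
  Module.End.mem_eigenspace_iff.1 ((Submodule.mem_iInf _).1 hv a)

/-- **Eigenbasis.** If `dim_ℂ W = [K:ℚ]` and every `σ`-eigenline of `θ : K → End_ℂ W` is a line,
then `W` has a basis `(b_σ)` indexed by the embeddings `σ : K → ℂ` with `b_σ` in the `σ`-eigenline
(there are `[K:ℚ] = dim W` embeddings, and eigenvectors of `θ(a₀)` for the pairwise distinct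
eigenvalues `σ(a₀)`, `a₀` a power-basis generator, are independent). [folklore] -/
theorem exists_basis_mem_eigenline (θ : K →+* Module.End ℂ W)
    (hW : Module.finrank ℂ W = Module.finrank ℚ K)
    (hline : ∀ σ : K →+* ℂ, Module.finrank ℂ (eigenline θ σ) = 1) :
    ∃ b : Basis (K →+* ℂ) ℂ W, ∀ σ, b σ ∈ eigenline θ σ := by
  -- a nonzero vector in each eigenline
  have hv : ∀ σ : K →+* ℂ, ∃ v : W, v ∈ eigenline θ σ ∧ v ≠ 0 := by
    intro σ
    have hne : eigenline θ σ ≠ ⊥ := by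
      intro hbot
      have h1 := hline σ
      rw [hbot, finrank_bot] at h1
      exact zero_ne_one h1
    obtain ⟨x, hx, hx0⟩ := Submodule.exists_mem_ne_zero_of_ne_bot hne
    exact ⟨x, hx, hx0⟩
  choose v hv hv0 using hv
  -- independence: eigenvectors of `θ a₀` for pairwise distinct eigenvalues
  set a₀ := (Field.powerBasisOfFiniteOfSeparable ℚ K).gen
  have hind : LinearIndependent ℂ v := by
    refine Module.End.eigenvectors_linearIndependent' (θ a₀) (fun σ : K →+* ℂ ↦ σ a₀)
      (ringHom_apply_gen_injective K) v fun σ ↦ ?_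
    exact ⟨(Submodule.mem_iInf _).1 (hv σ) a₀, hv0 σ⟩
  have hcard : Fintype.card (K →+* ℂ) = Module.finrank ℂ W := by rw [Embeddings.card, hW]
  exact ⟨basisOfLinearIndependentOfCardEqFinrank hind hcard, fun σ ↦ by
    rw [coe_basisOfLinearIndependentOfCardEqFinrank]; exact hv σ⟩

variable {M : Type} [Field M] [NumberField M]

omit [NumberField K] in
/-- **Support of the image of an eigenvector under an equivariant map.** Let `K` act on `W` by `θ`,
`M` on `W′` by `θ′`, `k : K → M`, and let `Ψ : W → W′` satisfy `Ψ ∘ θ(a) = θ′(k a) ∘ Ψ`.  If `v` is a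
`σ`-eigenvector and `(b′_τ)` an eigenbasis of `W′`, the `τ`-coordinate of `Ψ v` vanishes unless
`τ ∘ k = σ` (compare the `τ`-coordinates of `θ′(k a)(Ψ v) = σ(a) Ψ v`: `τ(k a) c_τ = σ(a) c_τ`).
[folklore] -/
theorem repr_apply_eq_zero_of_comp_ne (k : K →+* M) {θ : K →+* Module.End ℂ W}
    {θ' : M →+* Module.End ℂ W'} (Ψ : W →ₗ[ℂ] W') (hΨ : ∀ (a : K) (c : W), Ψ (θ a c) = θ' (k a) (Ψ c))
    (b' : Basis (M →+* ℂ) ℂ W') (hb' : ∀ τ, b' τ ∈ eigenline θ' τ) {v : W} {σ : K →+* ℂ}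
    (hv : v ∈ eigenline θ σ) {τ : M →+* ℂ} (hτ : τ.comp k ≠ σ) : b'.repr (Ψ v) τ = 0 := by
  set w := Ψ v with hw_def
  have hw : ∀ a : K, θ' (k a) w = σ a • w := fun a ↦ by
    rw [hw_def, ← hΨ, eigenline_apply_eq_smul hv, map_smul]
  have hne : ∃ a : K, τ (k a) ≠ σ a := by
    by_contra hall
    push Not at hall
    exact hτ (RingHom.ext fun a ↦ by simpa using hall a)
  obtain ⟨a, ha⟩ := hne
  -- the `τ`-coordinate of `θ′(k a) w`, computed in the eigenbasis and from `hw`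
  have e1 : b'.repr (θ' (k a) w) τ = τ (k a) * b'.repr w τ := by
    have hexp : θ' (k a) w = ∑ τ₁, (b'.repr w τ₁ * τ₁ (k a)) • b' τ₁ := by
      conv_lhs => rw [← b'.sum_repr w]
      rw [map_sum]
      refine Finset.sum_congr rfl fun τ₁ _ ↦ ?_
      rw [map_smul, eigenline_apply_eq_smul (hb' τ₁), smul_smul]
    have hrepr := congr_fun (b'.repr_sum_self fun τ₁ ↦ b'.repr w τ₁ * τ₁ (k a)) τ
    rw [hexp, hrepr, mul_comm]
  have e2 : b'.repr (θ' (k a) w) τ = σ a * b'.repr w τ := by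
    rw [hw a, map_smul, Finsupp.smul_apply, smul_eq_mul]
  have : (τ (k a) - σ a) * b'.repr w τ = 0 := by rw [sub_mul, ← e1, ← e2, sub_self]
  rcases mul_eq_zero.1 this with h0 | h0
  · exact absurd (sub_eq_zero.1 h0) ha
  · exact h0

end Eigen

/-! ## Hodge types of weight one in a fixed Hodge model -/

section HodgeTypes

variable {n : ℕ} {X : SchemeOver ℂ}

/-- Membership in the subspace `Θ⁻¹(H^{p,q}(X^an)) ⊆ Hᵏ(X(ℂ); ℂ)` cut out by a Hodge model `A₀` is
membership of the pull-back in `H^{p,q}`. [folklore] -/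
theorem mem_comap_hodgePQ_iff (A₀ : HodgeModel n X) {k p q : ℕ} {c : complexBetti X k} :
    c ∈ (A₀.hodgePQ k p q).comap (A₀.pullbackEquiv k).toLinearMap ↔ A₀.pullback k c ∈ A₀.hodgePQ k p q :=
  Iff.rfl

/-- Granted the model-independence of `H^{p,q}` (`hI`), a class is of Hodge type `(p,q)` iff it lies in
the subspace cut out by ANY fixed Hodge model `A₀`. [cite: VoisinHodgeI2002, Prop. 6.11 and §7.3.2] -/
theorem isOfHodgeType_iff_mem_comap (hI : hodgePQ_independent_of_hodgeModel) (hX : IsSmoothProjective n X)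
    (A₀ : HodgeModel n X) {k p q : ℕ} {c : complexBetti X k} :
    IsOfHodgeType n X k p q c ↔ c ∈ (A₀.hodgePQ k p q).comap (A₀.pullbackEquiv k).toLinearMap :=
  hI.isOfHodgeType_iff hX A₀

/-- **The subspaces of two distinct Hodge types `(p,q) ≠ (p′,q′)` with `p + q = p′ + q′ = k` are
disjoint** (the Hodge decomposition `Hᵏ(X^an; ℂ) = ⨁ H^{p,q}` of the model, `HodgeModel.isInternal_hodgePQ`,
transported to `ℂ ⊗_ℚ Hᵏ(X(ℂ); ℚ) ≅ Hᵏ(X(ℂ); ℂ)`, `HodgeModel.iSupIndep_ratPiece`).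
[cite: VoisinHodgeI2002, Cor. 6.10 and Cor. 6.14 (chunks p0120 L55, p0121 L31); §7.1.1] -/
theorem disjoint_comap_hodgePQ (hX : IsSmoothProjective n X) (A₀ : HodgeModel n X) {k p q p' q' : ℕ}
    (hpq : p + q = k) (hpq' : p' + q' = k) (hne : (p, q) ≠ (p', q')) :
    Disjoint ((A₀.hodgePQ k p q).comap (A₀.pullbackEquiv k).toLinearMap)
      ((A₀.hodgePQ k p' q').comap (A₀.pullbackEquiv k).toLinearMap) := by
  -- the transported pieces `Θ⁻¹(H^{p,q}) ⊆ ℂ ⊗_ℚ Hᵏ(X(ℂ); ℚ)` are independent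
  have hdis : Disjoint (A₀.ratPiece hX k p q) (A₀.ratPiece hX k p' q') :=
    (A₀.iSupIndep_ratPiece hX k).pairwiseDisjoint
      (i := ⟨(p, q), Finset.HasAntidiagonal.mem_antidiagonal.2 hpq⟩)
      (j := ⟨(p', q'), Finset.HasAntidiagonal.mem_antidiagonal.2 hpq'⟩)
      (fun h ↦ hne (congrArg Subtype.val h))
  rw [Submodule.disjoint_def]
  intro c hc hc'
  -- `c = β x`, and `Θ_{A₀} x = (β x)|_{X^an}` (`HodgeModel.complexification_apply`)
  obtain ⟨x, rfl⟩ := (ofRatClassBaseChangeEquiv hX k).surjective c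
  have hx : x ∈ A₀.ratPiece hX k p q := hc
  have hx' : x ∈ A₀.ratPiece hX k p' q' := hc'
  have hx0 : x = 0 := (Submodule.disjoint_def.1 hdis) x hx hx'
  rw [hx0, map_zero]

end HodgeTypes

/-! ## `K`-equivariant maps `H¹(A(ℂ); ℂ) → H¹(A′(ℂ); ℂ)` between realisations respect the Hodge types -/

section Equivariant

variable {K M : Type} [Field K] [NumberField K] [Field M] [NumberField M]
  (k : K →+* M) {Φ : CMType K}
  {A : AbelianVariety ℂ} {ι : 𝓞 K →+* End A} {θ : K →+* Module.End ℂ (complexBetti A.X 1)}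
  {A' : AbelianVariety ℂ} {ι' : 𝓞 M →+* End A'} {θ' : M →+* Module.End ℂ (complexBetti A'.X 1)}

/-- A realisation read on `H¹` comes with a Hodge model of the underlying variety (the Hodge-type clause
at any embedding, applied to a nonzero eigenvector). [folklore] -/
theorem IsCMTypeRealisation.nonempty_hodgeModel (h : IsCMTypeRealisation Φ A ι θ) :
    Nonempty (HodgeModel (Module.finrank ℚ K / 2) A.X) := by
  obtain ⟨b, hb⟩ := exists_basis_mem_eigenline θ h.2.1 fun σ ↦ (h.2.2.2 σ).1
  obtain ⟨σ₀⟩ := (inferInstance : Nonempty (K →+* ℂ))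
  by_cases hσ : σ₀ ∈ Φ.1
  · obtain ⟨A₀, -⟩ := (h.2.2.2 σ₀).2.1 hσ (b σ₀) (hb σ₀)
    exact ⟨A₀⟩
  · obtain ⟨A₀, -⟩ := (h.2.2.2 σ₀).2.2 hσ (b σ₀) (hb σ₀)
    exact ⟨A₀⟩

/-- The same Hodge model, indexed by the dimension `A.dim` of the abelian variety (`= [K:ℚ]/2`, by the
uniqueness of the dimension of a smooth projective model, `Motives.schemeDim_eq_holds`). [folklore] -/
theorem IsCMTypeRealisation.nonempty_hodgeModel_dim (h : IsCMTypeRealisation Φ A ι θ) :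
    Nonempty (HodgeModel A.dim A.X) := by
  rw [show A.dim = Module.finrank ℚ K / 2 from Motives.schemeDim_eq_holds h.1]
  exact h.nonempty_hodgeModel

open Classical in
/-- **A `K`-equivariant `ℂ`-linear map from `H¹` of a realisation of `(K; Φ)` to `H¹` of a realisation
of the INDUCED type `(M; Φ^M)`, `Φ^M = {τ | τ ∘ k ∈ Φ}` (`inducedCMType`), carries classes of type
`(1,0)` to type `(1,0)` and classes of type `(0,1)` to type `(0,1)`** (granted `hI`): the image of the
`σ`-eigenvector is supported on the `τ`-lines with `τ ∘ k = σ` (`repr_apply_eq_zero_of_comp_ne`), the two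
types are disjoint subspaces in a fixed model (`disjoint_comap_hodgePQ`), and `τ ∈ Φ^M ↔ τ ∘ k ∈ Φ`
(`mem_inducedCMType_iff`) matches the types. [folklore] -/
theorem isOfHodgeType_map_of_cmEquivariant (hI : hodgePQ_independent_of_hodgeModel)
    (h : IsCMTypeRealisation Φ A ι θ) (h' : IsCMTypeRealisation (inducedCMType k Φ) A' ι' θ')
    (Ψ : complexBetti A.X 1 →ₗ[ℂ] complexBetti A'.X 1) (hΨ : ∀ (a : K) (c : complexBetti A.X 1),
      Ψ (θ a c) = θ' (k a) (Ψ c))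
    {p q : ℕ} (hpq : (p, q) = (1, 0) ∨ (p, q) = (0, 1))
    {c : complexBetti A.X 1} (hc : IsOfHodgeType (Module.finrank ℚ K / 2) A.X 1 p q c) :
    IsOfHodgeType (Module.finrank ℚ M / 2) A'.X 1 p q (Ψ c) := by
  obtain ⟨b, hb⟩ := exists_basis_mem_eigenline θ h.2.1 fun σ ↦ (h.2.2.2 σ).1
  obtain ⟨b', hb'⟩ := exists_basis_mem_eigenline θ' h'.2.1 fun τ ↦ (h'.2.2.2 τ).1
  obtain ⟨A₀⟩ := h.nonempty_hodgeModel
  obtain ⟨A₀'⟩ := h'.nonempty_hodgeModel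
  -- the Hodge types, read in the fixed models
  have t10 : ∀ σ, σ ∈ Φ.1 → b σ ∈ (A₀.hodgePQ 1 1 0).comap (A₀.pullbackEquiv 1).toLinearMap :=
    fun σ hσ ↦ (isOfHodgeType_iff_mem_comap hI h.1 A₀).1 ((h.2.2.2 σ).2.1 hσ (b σ) (hb σ))
  have t01 : ∀ σ, σ ∉ Φ.1 → b σ ∈ (A₀.hodgePQ 1 0 1).comap (A₀.pullbackEquiv 1).toLinearMap :=
    fun σ hσ ↦ (isOfHodgeType_iff_mem_comap hI h.1 A₀).1 ((h.2.2.2 σ).2.2 hσ (b σ) (hb σ))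
  have t10' : ∀ τ, τ ∈ (inducedCMType k Φ).1 →
      b' τ ∈ (A₀'.hodgePQ 1 1 0).comap (A₀'.pullbackEquiv 1).toLinearMap :=
    fun τ hτ ↦ (isOfHodgeType_iff_mem_comap hI h'.1 A₀').1 ((h'.2.2.2 τ).2.1 hτ (b' τ) (hb' τ))
  have t01' : ∀ τ, τ ∉ (inducedCMType k Φ).1 →
      b' τ ∈ (A₀'.hodgePQ 1 0 1).comap (A₀'.pullbackEquiv 1).toLinearMap :=
    fun τ hτ ↦ (isOfHodgeType_iff_mem_comap hI h'.1 A₀').1 ((h'.2.2.2 τ).2.2 hτ (b' τ) (hb' τ))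
  have hd : Disjoint ((A₀.hodgePQ 1 1 0).comap (A₀.pullbackEquiv 1).toLinearMap)
      ((A₀.hodgePQ 1 0 1).comap (A₀.pullbackEquiv 1).toLinearMap) :=
    disjoint_comap_hodgePQ h.1 A₀ rfl rfl (by decide)
  rw [isOfHodgeType_iff_mem_comap hI h'.1 A₀']
  rw [isOfHodgeType_iff_mem_comap hI h.1 A₀] at hc
  rcases hpq with h10 | h01
  · obtain ⟨rfl, rfl⟩ := Prod.mk_inj.1 h10
    refine mem_of_apply_of_support b b' (fun σ ↦ σ ∈ Φ.1) (fun τ ↦ τ ∈ (inducedCMType k Φ).1) hd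
      t10 t01 t10' Ψ (fun σ hσ τ hτ ↦ ?_) hc
    refine repr_apply_eq_zero_of_comp_ne k Ψ hΨ b' hb' (hb σ) fun hτσ ↦ hτ ?_
    rw [mem_inducedCMType_iff, hτσ]
    exact hσ
  · obtain ⟨rfl, rfl⟩ := Prod.mk_inj.1 h01
    refine mem_of_apply_of_support b b' (fun σ ↦ σ ∉ Φ.1) (fun τ ↦ τ ∉ (inducedCMType k Φ).1) hd.symm
      t01 (fun σ hσ ↦ t10 σ (not_not.1 hσ)) t01' Ψ (fun σ hσ τ hτ ↦ ?_) hc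
    refine repr_apply_eq_zero_of_comp_ne k Ψ hΨ b' hb' (hb σ) fun hτσ ↦ hσ ?_
    rw [← hτσ, ← mem_inducedCMType_iff]
    exact not_not.1 hτ

/-- **A `K`-equivariant `ℚ`-linear map `ψ : H¹(A(ℂ); ℚ) → H¹(A′(ℂ); ℚ)` (for the rational CM actions) is
a morphism of rational Hodge structures of weight one**: its complexification `1 ⊗ ψ`, read on
`H¹(−; ℂ)` through `β : ℂ ⊗_ℚ H¹(−; ℚ) ≃ H¹(−; ℂ)` (`Motives.ofRatClassBaseChange`), carries classes of type
`(1,0)` to type `(1,0)` and classes of type `(0,1)` to type `(0,1)` (the two clauses of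
`HodgeTheory.IsHodgeMorphismOne A′ A ψ` of the record file `AbelianVarietyHodgeFullnessRecord`, spelled out),
granted `hI`. [folklore] -/
theorem cmEquivariant_respects_hodgeTypes (hI : hodgePQ_independent_of_hodgeModel)
    (h : IsCMTypeRealisation Φ A ι θ) (h' : IsCMTypeRealisation (inducedCMType k Φ) A' ι' θ')
    (hθ : IsInducedOnIntegers θ) (hθ' : IsInducedOnIntegers θ')
    (ψ : bettiCohomology A.X 1 →ₗ[ℚ] bettiCohomology A'.X 1)
    (hψ : ∀ (a : K) (v : bettiCohomology A.X 1), ψ (cmAction θ hθ a v) = cmAction θ' hθ' (k a) (ψ v)) :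
    (∀ x : ℂ ⊗[ℚ] bettiCohomology A.X 1,
        IsOfHodgeType A.dim A.X 1 1 0 (ofRatClassBaseChange (ComplexPoints A.X) 1 x) →
        IsOfHodgeType A'.dim A'.X 1 1 0
          (ofRatClassBaseChange (ComplexPoints A'.X) 1 (ψ.baseChange ℂ x))) ∧
    (∀ x : ℂ ⊗[ℚ] bettiCohomology A.X 1,
        IsOfHodgeType A.dim A.X 1 0 1 (ofRatClassBaseChange (ComplexPoints A.X) 1 x) →
        IsOfHodgeType A'.dim A'.X 1 0 1
          (ofRatClassBaseChange (ComplexPoints A'.X) 1 (ψ.baseChange ℂ x))) := by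
  have hdA : A.dim = Module.finrank ℚ K / 2 := Motives.schemeDim_eq_holds h.1
  have hdA' : A'.dim = Module.finrank ℚ M / 2 := Motives.schemeDim_eq_holds h'.1
  -- the complexified map on `H¹(−; ℂ)` through `β : ℂ ⊗ H¹(ℚ) ≃ H¹(ℂ)`
  let β := ofRatClassBaseChangeEquiv h.1 1
  let β' := ofRatClassBaseChangeEquiv h'.1 1
  let Ψ : complexBetti A.X 1 →ₗ[ℂ] complexBetti A'.X 1 :=
    (β'.toLinearMap ∘ₗ ψ.baseChange ℂ) ∘ₗ β.symm.toLinearMap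
  have hΨβ : ∀ t, Ψ (β t) = β' (ψ.baseChange ℂ t) := fun t ↦ by
    simp only [Ψ, LinearMap.coe_comp, LinearEquiv.coe_coe, Function.comp_apply, LinearEquiv.symm_apply_apply]
  have hΨ : ∀ (a : K) (c : complexBetti A.X 1), Ψ (θ a c) = θ' (k a) (Ψ c) := by
    intro a c
    obtain ⟨t, rfl⟩ := β.surjective c
    have hcomp : ψ ∘ₗ (cmAction θ hθ a) = (cmAction θ' hθ' (k a)) ∘ₗ ψ := LinearMap.ext fun v ↦ hψ a v
    have lhs : θ a (β t) = β ((cmAction θ hθ a).baseChange ℂ t) := by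
      rw [HodgeTheory.ofRatClassBaseChangeEquiv_apply, HodgeTheory.ofRatClassBaseChangeEquiv_apply,
        ofRatClassBaseChange_cmAction]
    rw [hΨβ t, lhs, hΨβ, ← LinearMap.comp_apply (f := ψ.baseChange ℂ), ← LinearMap.baseChange_comp,
      hcomp, LinearMap.baseChange_comp, LinearMap.comp_apply, HodgeTheory.ofRatClassBaseChangeEquiv_apply,
      HodgeTheory.ofRatClassBaseChangeEquiv_apply, ofRatClassBaseChange_cmAction]
  have clause : ∀ {p q : ℕ}, ((p, q) = (1, 0) ∨ (p, q) = (0, 1)) →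
      ∀ x : ℂ ⊗[ℚ] bettiCohomology A.X 1,
        IsOfHodgeType A.dim A.X 1 p q (ofRatClassBaseChange (ComplexPoints A.X) 1 x) →
        IsOfHodgeType A'.dim A'.X 1 p q (ofRatClassBaseChange (ComplexPoints A'.X) 1 (ψ.baseChange ℂ x)) := by
    intro p q hpq x hx
    have hx' : IsOfHodgeType (Module.finrank ℚ K / 2) A.X 1 p q (β x) := by
      rw [← hdA]; exact hx
    have := isOfHodgeType_map_of_cmEquivariant k hI h h' Ψ hΨ hpq hx'
    rw [hΨβ, ← hdA'] at this
    exact this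
  exact ⟨clause (Or.inl rfl), clause (Or.inr rfl)⟩

end Equivariant

/-! ## The theorems -/

section Theorems

/-! THE RIEMANN INPUT `hR`, an explicit hypothesis (no record is imported by this file): FULLNESS of
`A ↦ H¹_B(A, ℚ)` on complex abelian varieties up to isogeny — Deligne–Milne 1982 Thm. 6.20 (Riemann),
fullness conjunct — in the typed shape of the record `HodgeTheory.DeligneMilne1982_Thm_6_20_full`
(`HodgeTheory/AbelianVarietyHodgeFullnessRecord`): for complex abelian varieties `A`, `B` and a `ℚ`-linear
`ψ : H¹(B(ℂ); ℚ) → H¹(A(ℂ); ℚ)` whose complexification carries classes of type `(1,0)` to type `(1,0)` and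
classes of type `(0,1)` to type `(0,1)`, there are `u : A → B` and `k ≥ 1` with `u^* = k • ψ`; RESTRICTED
(premises `Nonempty (HodgeModel _ _)`) to abelian varieties BOTH carrying a Hodge model of the tree — the
only case used below (a realisation comes with a model, `IsCMTypeRealisation.nonempty_hodgeModel_dim`), and
a premise under which the Hodge-type clauses are not vacuous.  The record (in any typing with or without such
premises) supplies `hR` by a one-line lambda. -/
variable (hR : ∀ (A B : AbelianVariety ℂ) (ψ : bettiCohomology B.X 1 →ₗ[ℚ] bettiCohomology A.X 1),
    Nonempty (HodgeModel A.dim A.X) → Nonempty (HodgeModel B.dim B.X) →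
    (∀ x : ℂ ⊗[ℚ] bettiCohomology B.X 1,
        IsOfHodgeType B.dim B.X 1 1 0 (ofRatClassBaseChange (ComplexPoints B.X) 1 x) →
        IsOfHodgeType A.dim A.X 1 1 0 (ofRatClassBaseChange (ComplexPoints A.X) 1 (ψ.baseChange ℂ x))) →
    (∀ x : ℂ ⊗[ℚ] bettiCohomology B.X 1,
        IsOfHodgeType B.dim B.X 1 0 1 (ofRatClassBaseChange (ComplexPoints B.X) 1 x) →
        IsOfHodgeType A.dim A.X 1 0 1 (ofRatClassBaseChange (ComplexPoints A.X) 1 (ψ.baseChange ℂ x))) →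
    ∃ (u : A ⟶ B) (k : ℕ), 0 < k ∧ ∀ x, bettiCohomology.map u.hom.hom.hom 1 x = k • ψ x)

include hR


/-- KERNEL: **Riemann's theorem (`H¹_B` full on complex abelian varieties up to isogeny; Deligne–Milne 1982
Thm. 6.20, hypothesis `hR` above) implies Shimura's type inflation read on `H¹(−, ℚ)`** — the conclusion
of `Shimura1998_Thm3_inflation.rational`, for ANY number fields `K → M` (granted the model-independence of
Hodge types `hI`). [folklore] -/
theorem thm3_rational_of_riemann (hI : hodgePQ_independent_of_hodgeModel)
    {K M : Type} [Field K] [NumberField K] [Field M] [NumberField M]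
    (k : K →+* M) (Φ : CMType K)
    {A : AbelianVariety ℂ} {ι : 𝓞 K →+* End A} {θ : K →+* Module.End ℂ (complexBetti A.X 1)}
    {A' : AbelianVariety ℂ} {ι' : 𝓞 M →+* End A'} {θ' : M →+* Module.End ℂ (complexBetti A'.X 1)}
    (h : IsCMTypeRealisation Φ A ι θ) (h' : IsCMTypeRealisation (inducedCMType k Φ) A' ι' θ')
    (hθ : IsInducedOnIntegers θ) (hθ' : IsInducedOnIntegers θ') :
    ∃ (m : ℕ) (p : Fin m → (A'.X ⟶ A.X)),
      Function.Bijective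
        (∑ j : Fin m, pull (p j) 1 ∘ₗ LinearMap.proj j :
          (Fin m → bettiCohomology A.X 1) →ₗ[ℚ] bettiCohomology A'.X 1) ∧
      ∀ (j : Fin m) (a : K),
        pull (p j) 1 ∘ₗ (cmAction θ hθ a : Module.End ℚ (bettiCohomology A.X 1)) =
          (cmAction θ' hθ' (k a) : Module.End ℚ (bettiCohomology A'.X 1)) ∘ₗ pull (p j) 1 := by
  -- dimensions
  have hV : Module.finrank ℚ (bettiCohomology A.X 1) = Module.finrank ℚ K := by
    rw [HodgeTheory.BettiUniverse.finrank_bettiCohomology_eq h.1 1, h.2.1]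
  have hV' : Module.finrank ℚ (bettiCohomology A'.X 1) = Module.finrank ℚ M := by
    rw [HodgeTheory.BettiUniverse.finrank_bettiCohomology_eq h'.1 1, h'.2.1]
  haveI : Module.Finite ℚ (bettiCohomology A.X 1) :=
    Module.finite_of_finrank_pos (by rw [hV]; exact Module.finrank_pos)
  haveI : Module.Finite ℚ (bettiCohomology A'.X 1) :=
    Module.finite_of_finrank_pos (by rw [hV']; exact Module.finrank_pos)
  -- the rational CM actions
  let ρ : K →ₐ[ℚ] Module.End ℚ (bettiCohomology A.X 1) := cmAction θ hθ
  let ρ' : K →ₐ[ℚ] Module.End ℚ (bettiCohomology A'.X 1) := (cmAction θ' hθ').comp k.toRatAlgHom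
  -- (1) `K`-linear coordinates
  obtain ⟨m, ψ, hbij, hequiv⟩ := exists_cmLinear_sum_bijective ρ ρ' hV
  have hequiv' : ∀ (j : Fin m) (a : K) (v : bettiCohomology A.X 1),
      ψ j (cmAction θ hθ a v) = cmAction θ' hθ' (k a) (ψ j v) := fun j a v ↦ by
    simpa [ρ, ρ'] using hequiv j a v
  -- (2) each `ψ_j` is a morphism of rational Hodge structures of weight one
  have hHodge := fun j : Fin m ↦ cmEquivariant_respects_hodgeTypes k hI h h' hθ hθ' (ψ j) (hequiv' j)
  -- (3) fullness: `u_j : A′ → A` with `u_j^* = n_j • ψ_j`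
  have hfull := fun j : Fin m ↦
    hR A' A (ψ j) h'.nonempty_hodgeModel_dim h.nonempty_hodgeModel_dim (hHodge j).1 (hHodge j).2
  choose u n hn hu using hfull
  refine ⟨m, fun j ↦ (u j).hom.hom.hom, ?_, fun j a ↦ ?_⟩
  · exact bijective_sum_proj_of_nsmul ψ (fun j ↦ pull (u j).hom.hom.hom 1) hbij n hn fun j x ↦ hu j x
  · -- equivariance on `H¹(−; ℚ)`: `u_j^* = n_j • ψ_j` and `ψ_j` is `K`-linear
    refine LinearMap.ext fun x ↦ ?_
    rw [LinearMap.comp_apply, LinearMap.comp_apply]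
    change pull (u j).hom.hom.hom 1 (cmAction θ hθ a x) = cmAction θ' hθ' (k a) (pull (u j).hom.hom.hom 1 x)
    rw [show pull (u j).hom.hom.hom 1 (cmAction θ hθ a x) = n j • ψ j (cmAction θ hθ a x) from hu j _,
      show pull (u j).hom.hom.hom 1 x = n j • ψ j x from hu j x, map_nsmul, hequiv' j a x]

/-- KERNEL: **type inflation on coded fields, read on the rational CM actions, from Riemann's theorem** —
the conclusion of `Shimura1998_Thm3_inflation.rational_transport` (code fields `e₁ : K ≃ E₁`, `e₂ : M ≃ E₂`,
transported types `Φ₁`, `Φ₂`, realisations of `(E₁; Φ₁)` and `(E₂; Φ₂)`, actions `cmAction (θ ∘ e₁)`,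
`cmAction (θ′ ∘ e₂)`), from `hR` and `hI` instead of `Shimura1998_Thm3_inflation`. [folklore] -/
theorem thm3_rational_transport_of_riemann (hI : hodgePQ_independent_of_hodgeModel)
    {K M E₁ E₂ : Type} [Field K] [NumberField K] [Field M] [NumberField M]
    [Field E₁] [NumberField E₁] [Field E₂] [NumberField E₂]
    (k : K →+* M) (Φ : CMType K) (e₁ : K ≃+* E₁) (e₂ : M ≃+* E₂) {Φ₁ : CMType E₁} {Φ₂ : CMType E₂}
    (hΦ₁ : ∀ τ : E₁ →+* ℂ, τ ∈ Φ₁.1 ↔ τ.comp e₁.toRingHom ∈ Φ.1)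
    (hΦ₂ : ∀ τ : E₂ →+* ℂ, τ ∈ Φ₂.1 ↔ (τ.comp e₂.toRingHom).comp k ∈ Φ.1)
    {A : AbelianVariety ℂ} {ι : 𝓞 E₁ →+* End A} {θ : E₁ →+* Module.End ℂ (complexBetti A.X 1)}
    {A' : AbelianVariety ℂ} {ι' : 𝓞 E₂ →+* End A'} {θ' : E₂ →+* Module.End ℂ (complexBetti A'.X 1)}
    (h : IsCMTypeRealisation Φ₁ A ι θ) (h' : IsCMTypeRealisation Φ₂ A' ι' θ')
    (hθ : IsInducedOnIntegers (θ.comp e₁.toRingHom)) (hθ' : IsInducedOnIntegers (θ'.comp e₂.toRingHom)) :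
    ∃ (m : ℕ) (p : Fin m → (A'.X ⟶ A.X)),
      Function.Bijective
        (∑ j : Fin m, pull (p j) 1 ∘ₗ LinearMap.proj j :
          (Fin m → bettiCohomology A.X 1) →ₗ[ℚ] bettiCohomology A'.X 1) ∧
      ∀ (j : Fin m) (a : K),
        pull (p j) 1 ∘ₗ (cmAction (θ.comp e₁.toRingHom) hθ a : Module.End ℚ (bettiCohomology A.X 1)) =
          (cmAction (θ'.comp e₂.toRingHom) hθ' (k a) : Module.End ℚ (bettiCohomology A'.X 1)) ∘ₗ
            pull (p j) 1 := by
  set k₀ : E₁ →+* E₂ := e₂.toRingHom.comp (k.comp e₁.symm.toRingHom) with hk₀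
  have hind : inducedCMType k₀ Φ₁ = Φ₂ := inducedCMType_transport k Φ e₁ e₂ hΦ₁ hΦ₂
  have h'' : IsCMTypeRealisation (inducedCMType k₀ Φ₁) A' ι' θ' := by rw [hind]; exact h'
  obtain ⟨m, p, hbij, hcomm⟩ :=
    thm3_rational_of_riemann hR hI k₀ Φ₁ h h'' h.isInducedOnIntegers h'.isInducedOnIntegers
  refine ⟨m, p, hbij, fun j a ↦ ?_⟩
  have hk : e₂ (k a) = k₀ (e₁ a) := by simp [hk₀]
  rw [cmAction_comp_ringEquiv θ h.isInducedOnIntegers e₁ hθ a,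
    cmAction_comp_ringEquiv θ' h'.isInducedOnIntegers e₂ hθ' (k a), hk]
  exact hcomm j (e₁ a)

end Theorems

end Literature.AlgebraicGeometry.ComplexMultiplication

end
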